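import Literature.NumberTheory.GaloisCohomology.PBasisKoszulOperators
import HarnessLib

/-!
# The homotopy identity `d ∘ h + h ∘ d = 1 - π` for the de Rham complex of a ring with a `p`-basis

Continuation of `PBasisKoszulOperators.lean`.  For a ring `R` of characteristic `p` with a finite `p`-basis
`t : ι → R` (`ι` linearly ordered), the Koszul contraction `h = IsPBasis.hTwist` and the Cartier projector
`π = IsPBasis.πTwist` on the Frobenius-twisted forms `Ωⁿ_R` satisfy

  `d ∘ h + h ∘ d = 1 - π`   (`dTwist_hTwist_add_hTwist_dTwist`; `hTwist_dTwist_zero` in degree `0`),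

i.e. the part of the de Rham complex with a live index is contractible and the complex retracts onto the
Cartier vectors `t_s^{p-1} dt_s` — the heart of the Cartier isomorphism (`CartierIsomorphism.lean`:
`Zⁿ = Bⁿ ⊕ ⟨t_s^{p-1} dt_s⟩`, `Ωⁿ/Bⁿ` free, `γ : Ωⁿ ≅ Hⁿ`).  The proof is the classical matrix computation
on the monomial basis `E (α, s) = t^α • dt_s`: three cases — no live index (everything vanishes), minimal live
index `i₀ ∉ s` (`h (d E) = E`), minimal live index `i₀ ∈ s` (`d (h E) = E −` the terms of `h (d E)`, the signs
cancelling by `insertSign_bracket`).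

## References

* L. Illusie, *Complexe de de Rham–Witt et cohomologie cristalline*, Ann. Sci. ÉNS 12 (1979), 0.2
  (Cartier isomorphism via the grading of the de Rham complex of a polynomial algebra). [Illusie1979]
* N. Katz, *Nilpotent connections and the monodromy theorem*, Publ. IHÉS 39 (1970), Thm. 7.2. [folklore]
-/

noncomputable section

open scoped BigOperators
open KaehlerDifferential (D)
open Literature.AlgebraicGeometry.Crystalline (insertSign coe_insertSign)

namespace Literature.NumberTheory.GaloisCohomology

universe u v

namespace IsPBasis

open DeRhamWeights

variable {p : ℕ} [hp : Fact p.Prime] {R : Type u} [CommRing R] [CharP R p] {ι : Type v} [Fintype ι]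
  [LinearOrder ι] {t : ι → R}

/-! ### The homotopy identity on basis vectors -/

section Identity

variable (h : IsPBasis p t)

/-- The coefficient of the `i`-th term of `d (E (α, s))` (`PBasisForms.dTwist_twistFormBasis`). [folklore] -/
private theorem dTwist_basis_expand (n : ℕ) (α : ι → Fin p) (s : Set.powersetCard ι n) :
    dTwist p R n (h.twistFormBasis n (α, s)) =
      ∑ i, if hi : i ∉ (s : Finset ι) then
        (((α i : ℕ) : ℤ) * ((insertSign (s : Finset ι) i : ℤˣ) : ℤ)) •
          h.twistFormBasis (n + 1) (α - Pi.single i 1, insertIdx s i hi)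
      else 0 :=
  h.dTwist_twistFormBasis n α s

/-- `h (d E)` expanded termwise. [folklore] -/
private theorem hTwist_dTwist_basis (n : ℕ) (α : ι → Fin p) (s : Set.powersetCard ι (n + 1)) :
    h.hTwist (n + 1) (dTwist p R (n + 1) (h.twistFormBasis (n + 1) (α, s))) =
      ∑ i, if hi : i ∉ (s : Finset ι) then
        (((α i : ℕ) : ℤ) * ((insertSign (s : Finset ι) i : ℤˣ) : ℤ)) •
          h.hVec (n + 1) (α - Pi.single i 1, insertIdx s i hi)
      else 0 := by
  rw [dTwist_basis_expand, map_sum]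
  refine Finset.sum_congr rfl fun i _ => ?_
  split_ifs with hi
  · rw [map_zero]
  · rw [map_zsmul, hTwist_basis]

/-- `h (d E)` in degree `0`, expanded termwise. [folklore] -/
private theorem hTwist_dTwist_basis_zero (α : ι → Fin p) (s : Set.powersetCard ι 0) :
    h.hTwist 0 (dTwist p R 0 (h.twistFormBasis 0 (α, s))) =
      ∑ i, if hi : i ∉ (s : Finset ι) then
        (((α i : ℕ) : ℤ) * ((insertSign (s : Finset ι) i : ℤˣ) : ℤ)) •
          h.hVec 0 (α - Pi.single i 1, insertIdx s i hi)
      else 0 := by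
  rw [dTwist_basis_expand, map_sum]
  refine Finset.sum_congr rfl fun i _ => ?_
  split_ifs with hi
  · rw [map_zero]
  · rw [map_zsmul, hTwist_basis]

/-- **Case B of the homotopy identity** (live set nonempty, minimum `i₀ ∉ s`): `h (d E) = E`.  The `i₀`-th
term of `h (d E)` is `E` (coefficient `α_{i₀} ε · w⁻¹ ε ≡ 1`), all other terms vanish (`h` kills them since
`i₀` is still the minimal live index and is not in `insert i s`). [cite: Illusie1979, 0.2] -/
theorem hd_terms_caseB (n : ℕ) (α : ι → Fin p) (s : Set.powersetCard ι n)
    (hl : (live α (s : Finset ι)).Nonempty) {i₀ : ι} (hmin : (live α (s : Finset ι)).min' hl = i₀)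
    (hi₀ : i₀ ∉ (s : Finset ι)) (i : ι) :
    (if hi : i ∉ (s : Finset ι) then
        (((α i : ℕ) : ℤ) * ((insertSign (s : Finset ι) i : ℤˣ) : ℤ)) •
          h.hVec n (α - Pi.single i 1, insertIdx s i hi)
      else 0) = if i = i₀ then h.twistFormBasis n (α, s) else 0 := by
  have hα₀ : α i₀ ≠ 0 := (mem_live_iff_of_not_mem hi₀).1 (hmin ▸ Finset.min'_mem _ hl)
  by_cases his : i ∈ (s : Finset ι)
  · rw [dif_neg (not_not.2 his), if_neg]
    rintro rfl
    exact hi₀ his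
  rw [dif_pos his]
  by_cases hα : α i = 0
  · rw [hα, Fin.val_zero, Nat.cast_zero, zero_mul, zero_zsmul, if_neg]
    rintro rfl
    exact hα₀ hα
  -- the moved vector has the same live set, hence the same minimum `i₀`
  have hlive : live (α - Pi.single i 1) (insert i (s : Finset ι)) = live α (s : Finset ι) :=
    live_dMove his hα
  have hl' : (live (α - Pi.single i 1) ((insertIdx s i his : Set.powersetCard ι (n + 1)) : Finset ι)).Nonempty := by
    rw [coe_insertIdx, hlive]; exact hl
  have hmin' : (live (α - Pi.single i 1) ((insertIdx s i his : Set.powersetCard ι (n + 1)) : Finset ι)).min' hl'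
      = i₀ := by
    rw [← hmin]; exact min'_eq_of_eq (by rw [coe_insertIdx, hlive]) _ _
  by_cases hii : i = i₀
  · subst hii
    rw [if_pos rfl]
    have hmem : i ∈ ((insertIdx s i his : Set.powersetCard ι (n + 1)) : Finset ι) := by
      rw [coe_insertIdx]; exact Finset.mem_insert_self i _
    rw [h.hVec_of_min_mem n hl' hmin' hmem, smul_smul]
    -- indices
    have hidx : (eraseIdx (insertIdx s i his) i hmem : Set.powersetCard ι n) = s := eraseIdx_insertIdx s i his hmem
    have hwt : wt (α - Pi.single i 1) ((insertIdx s i his : Set.powersetCard ι (n + 1)) : Finset ι) i =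
        (α i : ℕ) := by
      rw [coe_insertIdx, show wt (α - Pi.single i 1) (insert i (s : Finset ι)) = wt α (s : Finset ι) from
        wt_dMove his hα, wt_of_not_mem his]
    have hsgn : ((insertIdx s i his : Set.powersetCard ι (n + 1)) : Finset ι).erase i = (s : Finset ι) := by
      rw [coe_insertIdx, Finset.erase_insert his]
    rw [hidx, hwt, hsgn, sub_add_cancel]
    -- the coefficient `α_i ε · w⁻¹ ε ≡ 1 (mod p)`
    apply zsmul_eq_self_of_modEq_one (R := R) (p := p)
    have hw : 0 < (α i : ℕ) := Nat.pos_of_ne_zero fun h0 => hα (Fin.ext (by rw [h0, Fin.val_zero]))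
    have key := invWt_mul_modEq p hw (α i).2
    calc (((α i : ℕ) : ℤ) * ((insertSign (s : Finset ι) i : ℤˣ) : ℤ)) *
          (invWt p (α i : ℕ) * ((insertSign (s : Finset ι) i : ℤˣ) : ℤ))
        = invWt p (α i : ℕ) * (α i : ℕ) *
            (((insertSign (s : Finset ι) i : ℤˣ) : ℤ) * ((insertSign (s : Finset ι) i : ℤˣ) : ℤ)) := by ring
      _ = invWt p (α i : ℕ) * (α i : ℕ) := by rw [coe_insertSign_mul_self, mul_one]
      _ ≡ 1 [ZMOD p] := key
  · rw [if_neg hii]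
    have hnot : i₀ ∉ ((insertIdx s i his : Set.powersetCard ι (n + 1)) : Finset ι) := by
      rw [coe_insertIdx, Finset.mem_insert]
      rintro (h0 | h0)
      · exact hii h0.symm
      · exact hi₀ h0
    rw [h.hVec_of_min_not_mem n hl' hmin' hnot, smul_zero]

/-- **Case C**: no live index — every term of `h (d E)` vanishes (all `α i = 0` off `s`). [folklore] -/
theorem hd_terms_caseC (n : ℕ) (α : ι → Fin p) (s : Set.powersetCard ι n)
    (hl : live α (s : Finset ι) = ∅) (i : ι) :
    (if hi : i ∉ (s : Finset ι) then
        (((α i : ℕ) : ℤ) * ((insertSign (s : Finset ι) i : ℤˣ) : ℤ)) •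
          h.hVec n (α - Pi.single i 1, insertIdx s i hi)
      else 0) = 0 := by
  by_cases his : i ∈ (s : Finset ι)
  · rw [dif_neg (not_not.2 his)]
  · rw [dif_pos his, apply_eq_zero_of_live_eq_empty hl his, Fin.val_zero, Nat.cast_zero, zero_mul, zero_zsmul]

/-- **Case A of the homotopy identity** (live set nonempty, minimum `i₀ ∈ s`), termwise: with
`h E = c • E (α', s')` (`α' = α + e_{i₀}`, `s' = s ∖ i₀`, `c = w⁻¹ ε(s', i₀)`), the `i`-th term of
`d (h E) = c • d E(α', s')` plus the `i`-th term of `h (d E)` is `E` for `i = i₀` and `0` otherwise (the signs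
cancel by `insertSign_bracket`). [cite: Illusie1979, 0.2] -/
theorem dh_add_hd_terms_caseA (n : ℕ) (α : ι → Fin p) (s : Set.powersetCard ι (n + 1))
    (hl : (live α (s : Finset ι)).Nonempty) {i₀ : ι} (hmin : (live α (s : Finset ι)).min' hl = i₀)
    (hi₀ : i₀ ∈ (s : Finset ι)) (i : ι) :
    (invWt p (wt α (s : Finset ι) i₀) * ((insertSign ((s : Finset ι).erase i₀) i₀ : ℤˣ) : ℤ)) •
        (if hi : i ∉ ((eraseIdx s i₀ hi₀ : Set.powersetCard ι n) : Finset ι) then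
          ((((α + Pi.single i₀ 1 : ι → Fin p) i : ℕ) : ℤ) *
              ((insertSign ((eraseIdx s i₀ hi₀ : Set.powersetCard ι n) : Finset ι) i : ℤˣ) : ℤ)) •
            h.twistFormBasis (n + 1) (α + Pi.single i₀ 1 - Pi.single i 1, insertIdx (eraseIdx s i₀ hi₀) i hi)
        else 0) +
      (if hi : i ∉ (s : Finset ι) then
        (((α i : ℕ) : ℤ) * ((insertSign (s : Finset ι) i : ℤˣ) : ℤ)) •
          h.hVec (n + 1) (α - Pi.single i 1, insertIdx s i hi)
      else 0) =
    if i = i₀ then h.twistFormBasis (n + 1) (α, s) else 0 := by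
  have hlive₀ : i₀ ∈ live α (s : Finset ι) := hmin ▸ Finset.min'_mem _ hl
  have hα₀ : (α i₀ : ℕ) + 1 < p := (mem_live_iff_of_mem hi₀).1 hlive₀
  have hw : wt α (s : Finset ι) i₀ = (α i₀ : ℕ) + 1 := wt_of_mem hi₀
  by_cases hii : i = i₀
  · -- the diagonal term: `d (h E)` contributes `E`, `h (d E)` contributes nothing (`i₀ ∈ s`)
    subst hii
    rw [if_pos rfl, dif_neg (not_not.2 hi₀), add_zero]
    have hi' : i ∉ ((eraseIdx s i hi₀ : Set.powersetCard ι n) : Finset ι) := by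
      rw [coe_eraseIdx]; exact Finset.notMem_erase i _
    rw [dif_pos hi', smul_smul, insertIdx_eraseIdx s i hi₀ hi', add_sub_cancel_right, coe_eraseIdx,
      val_add_single_self hα₀, hw]
    apply zsmul_eq_self_of_modEq_one (R := R) (p := p)
    have key := invWt_mul_modEq p (Nat.succ_pos (α i : ℕ)) hα₀
    calc invWt p ((α i : ℕ) + 1) * ((insertSign ((s : Finset ι).erase i) i : ℤˣ) : ℤ) *
          ((((α i : ℕ) + 1 : ℕ) : ℤ) * ((insertSign ((s : Finset ι).erase i) i : ℤˣ) : ℤ))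
        = invWt p ((α i : ℕ) + 1) * (((α i : ℕ) + 1 : ℕ) : ℤ) *
            (((insertSign ((s : Finset ι).erase i) i : ℤˣ) : ℤ) *
              ((insertSign ((s : Finset ι).erase i) i : ℤˣ) : ℤ)) := by ring
      _ = invWt p ((α i : ℕ) + 1) * (((α i : ℕ) + 1 : ℕ) : ℤ) := by rw [coe_insertSign_mul_self, mul_one]
      _ ≡ 1 [ZMOD p] := key
  rw [if_neg hii]
  by_cases his : i ∈ (s : Finset ι)
  · -- `i ∈ s`, `i ≠ i₀`: both terms vanish
    have : i ∈ ((eraseIdx s i₀ hi₀ : Set.powersetCard ι n) : Finset ι) := by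
      rw [coe_eraseIdx]; exact Finset.mem_erase.2 ⟨hii, his⟩
    rw [dif_neg (not_not.2 this), dif_neg (not_not.2 his), smul_zero, add_zero]
  have hi' : i ∉ ((eraseIdx s i₀ hi₀ : Set.powersetCard ι n) : Finset ι) := by
    rw [coe_eraseIdx]; exact fun h0 => his (Finset.mem_of_mem_erase h0)
  rw [dif_pos hi', dif_pos his]
  have hαi : ((α + Pi.single i₀ 1 : ι → Fin p) i) = α i := add_single_apply_of_ne α hii
  by_cases hα : α i = 0
  · -- dead index: both coefficients vanish
    rw [hαi, hα, Fin.val_zero, Nat.cast_zero, zero_mul, zero_zsmul, smul_zero, zero_mul, zero_zsmul, add_zero]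
  -- live index `i ∉ s`, `i ≠ i₀`: the two terms cancel
  have hlive : live (α - Pi.single i 1) (insert i (s : Finset ι)) = live α (s : Finset ι) :=
    live_dMove his hα
  have hl' : (live (α - Pi.single i 1) ((insertIdx s i his : Set.powersetCard ι (n + 2)) : Finset ι)).Nonempty := by
    rw [coe_insertIdx, hlive]; exact hl
  have hmin' : (live (α - Pi.single i 1) ((insertIdx s i his : Set.powersetCard ι (n + 2)) : Finset ι)).min' hl'
      = i₀ := by
    rw [← hmin]; exact min'_eq_of_eq (by rw [coe_insertIdx, hlive]) _ _
  have hmem : i₀ ∈ ((insertIdx s i his : Set.powersetCard ι (n + 2)) : Finset ι) := by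
    rw [coe_insertIdx]; exact Finset.mem_insert_of_mem hi₀
  rw [h.hVec_of_min_mem (n + 1) hl' hmin' hmem, smul_smul, smul_smul]
  have hidx : (eraseIdx (insertIdx s i his) i₀ hmem : Set.powersetCard ι (n + 1)) =
      insertIdx (eraseIdx s i₀ hi₀) i hi' := eraseIdx_insertIdx_of_ne s hii his hmem hi₀ hi'
  have hwt : wt (α - Pi.single i 1) ((insertIdx s i his : Set.powersetCard ι (n + 2)) : Finset ι) i₀ =
      wt α (s : Finset ι) i₀ := by
    rw [coe_insertIdx, show wt (α - Pi.single i 1) (insert i (s : Finset ι)) = wt α (s : Finset ι) from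
      wt_dMove his hα]
  have hset : ((insertIdx s i his : Set.powersetCard ι (n + 2)) : Finset ι).erase i₀ =
      insert i ((s : Finset ι).erase i₀) := by
    rw [coe_insertIdx, Finset.erase_insert_of_ne hii]
  rw [hidx, hwt, hset, sub_add_eq_add_sub, hαi, coe_eraseIdx, ← add_zsmul]
  -- the bracket of signs vanishes
  have hs : (s : Finset ι) = insert i₀ ((s : Finset ι).erase i₀) := (Finset.insert_erase hi₀).symm
  have hb := insertSign_bracket ((s : Finset ι).erase i₀) (Finset.notMem_erase i₀ _)
    (fun h0 => his (Finset.mem_of_mem_erase h0)) (Ne.symm hii)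
  rw [← hs] at hb
  have : invWt p (wt α (s : Finset ι) i₀) * ((insertSign ((s : Finset ι).erase i₀) i₀ : ℤˣ) : ℤ) *
        (((α i : ℕ) : ℤ) * ((insertSign ((s : Finset ι).erase i₀) i : ℤˣ) : ℤ)) +
      ((α i : ℕ) : ℤ) * ((insertSign (s : Finset ι) i : ℤˣ) : ℤ) *
        (invWt p (wt α (s : Finset ι) i₀) *
          ((insertSign (insert i ((s : Finset ι).erase i₀)) i₀ : ℤˣ) : ℤ)) =
      invWt p (wt α (s : Finset ι) i₀) * ((α i : ℕ) : ℤ) *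
        (((insertSign ((s : Finset ι).erase i₀) i₀ : ℤˣ) : ℤ) * (insertSign ((s : Finset ι).erase i₀) i : ℤˣ) +
          (insertSign (s : Finset ι) i : ℤˣ) * (insertSign (insert i ((s : Finset ι).erase i₀)) i₀ : ℤˣ)) := by
    ring
  rw [this, hb, mul_zero, zero_zsmul]

/-- **The homotopy identity on a basis vector of positive degree.** [cite: Illusie1979, 0.2] -/
theorem dh_add_hd_basis (n : ℕ) (α : ι → Fin p) (s : Set.powersetCard ι (n + 1)) :
    dTwist p R n (h.hTwist n (h.twistFormBasis (n + 1) (α, s))) +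
        h.hTwist (n + 1) (dTwist p R (n + 1) (h.twistFormBasis (n + 1) (α, s))) =
      h.twistFormBasis (n + 1) (α, s) - h.πTwist (n + 1) (h.twistFormBasis (n + 1) (α, s)) := by
  rw [hTwist_basis, hTwist_dTwist_basis, πTwist_basis]
  by_cases hl : (live α (s : Finset ι)).Nonempty
  · rw [h.πVec_of_live_nonempty (n + 1) hl, sub_zero]
    by_cases hi₀ : (live α (s : Finset ι)).min' hl ∈ (s : Finset ι)
    · -- Case A
      rw [h.hVec_of_min_mem n hl rfl hi₀, map_zsmul, dTwist_basis_expand, Finset.smul_sum,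
        ← Finset.sum_add_distrib]
      rw [Finset.sum_congr rfl fun i _ => h.dh_add_hd_terms_caseA n α s hl rfl hi₀ i]
      rw [Finset.sum_ite_eq' Finset.univ, if_pos (Finset.mem_univ _)]
    · -- Case B
      rw [h.hVec_of_min_not_mem n hl rfl hi₀, map_zero, zero_add]
      rw [Finset.sum_congr rfl fun i _ => h.hd_terms_caseB (n + 1) α s hl rfl hi₀ i]
      rw [Finset.sum_ite_eq' Finset.univ, if_pos (Finset.mem_univ _)]
  · -- Case C
    have hl' : live α (s : Finset ι) = ∅ := Finset.not_nonempty_iff_eq_empty.1 hl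
    rw [h.hVec_of_live_eq_empty n hl', map_zero, zero_add, h.πVec_of_live_eq_empty (n + 1) hl', sub_self]
    exact Finset.sum_eq_zero fun i _ => h.hd_terms_caseC (n + 1) α s hl' i

/-- **The homotopy identity on a basis vector of degree `0`** (`h ∘ d = 1 - π` there). [cite: Illusie1979, 0.2] -/
theorem hd_basis_zero (α : ι → Fin p) (s : Set.powersetCard ι 0) :
    h.hTwist 0 (dTwist p R 0 (h.twistFormBasis 0 (α, s))) =
      h.twistFormBasis 0 (α, s) - h.πTwist 0 (h.twistFormBasis 0 (α, s)) := by
  rw [hTwist_dTwist_basis_zero, πTwist_basis]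
  have hs : (s : Finset ι) = ∅ := Finset.card_eq_zero.1 (Set.powersetCard.card_eq s)
  by_cases hl : (live α (s : Finset ι)).Nonempty
  · rw [h.πVec_of_live_nonempty 0 hl, sub_zero]
    have hi₀ : (live α (s : Finset ι)).min' hl ∉ (s : Finset ι) := Finset.eq_empty_iff_forall_notMem.1 hs _
    rw [Finset.sum_congr rfl fun i _ => h.hd_terms_caseB 0 α s hl rfl hi₀ i]
    rw [Finset.sum_ite_eq' Finset.univ, if_pos (Finset.mem_univ _)]
  · have hl' : live α (s : Finset ι) = ∅ := Finset.not_nonempty_iff_eq_empty.1 hl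
    rw [h.πVec_of_live_eq_empty 0 hl', sub_self]
    exact Finset.sum_eq_zero fun i _ => h.hd_terms_caseC 0 α s hl' i

end Identity

/-! ### The homotopy identity -/

/-- **`d ∘ h + h ∘ d = 1 - π`** on twisted forms of positive degree: the Koszul contraction is a homotopy
between the identity and the projector onto the Cartier vectors. [cite: Illusie1979, 0.2] -/
theorem dTwist_hTwist_add_hTwist_dTwist (h : IsPBasis p t) (n : ℕ)
    (x : FrobeniusTwist p R (⋀[R]^(n + 1) (Ω[R⁄ℤ]))) :
    dTwist p R n (h.hTwist n x) + h.hTwist (n + 1) (dTwist p R (n + 1) x) = x - h.πTwist (n + 1) x := by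
  have key : dTwist p R n ∘ₗ h.hTwist n + h.hTwist (n + 1) ∘ₗ dTwist p R (n + 1) =
      LinearMap.id - h.πTwist (n + 1) := by
    refine (h.twistFormBasis (n + 1)).ext fun αs => ?_
    obtain ⟨α, s⟩ := αs
    simpa using h.dh_add_hd_basis n α s
  simpa using LinearMap.congr_fun key x

/-- **`h ∘ d = 1 - π`** on twisted `0`-forms (functions). [cite: Illusie1979, 0.2] -/
theorem hTwist_dTwist_zero (h : IsPBasis p t) (x : FrobeniusTwist p R (⋀[R]^0 (Ω[R⁄ℤ]))) :
    h.hTwist 0 (dTwist p R 0 x) = x - h.πTwist 0 x := by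
  have key : h.hTwist 0 ∘ₗ dTwist p R 0 = LinearMap.id - h.πTwist 0 := by
    refine (h.twistFormBasis 0).ext fun αs => ?_
    obtain ⟨α, s⟩ := αs
    simpa using h.hd_basis_zero α s
  simpa using LinearMap.congr_fun key x

end IsPBasis

end Literature.NumberTheory.GaloisCohomology

end
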